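import Summits.Ventures.CertifiedManyBodySolver.Rows.AndersonDominatedByLTI
import Summits.HubbardSuperconductivity.ManyBodyBootstrap.Bounds.AndersonRowsChain10
import Summits.HubbardSuperconductivity.ManyBodyBootstrap.Bounds.AndersonRowsChain15
import HarnessLib

/-!
# The GLUING-DOMINATES-ANDERSON edge — part 2: the edges into the four chain node predicates, M1 cells, worked instances

HONEST FRAMING: first certified bounds; not a superconductivity verdict; every number certified or labelled float.

Continuation of `Rows/AndersonDominatedByLTI.lean` (module docstring, conventions and the raw edge
`re_firstBond_ge_of_andersonChain` live there): from the raw edge and the two LTI identities, one short corollary per chain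
node predicate of `Rows/ChainMarginalNodes.lean` (`LTIChainNode`, `LTIChainKSDNNode` = FORMAT-ltisdp, `EntChainNode`,
`EntTLMChainNode` = op-08's `tl_marginal` form) at every filling, the half-filled real-`U` forms, the M1 cells
`m1[Doped]EnergyLowerRow_of_andersonChain_via_lti[_le]`, and §6: the edge instantiated BY NAME on the two lane-A rows OF RECORD
#232 (`anderson_psd_chain_l10_opt_U8`, `ℓ = 10`) and #297 (`anderson_psd_cw_chain_l15_U8_v040`, `ℓ = 15`), `U = 8` — hypotheses =
their OPEN claim nodes of `Bounds/AndersonRowsChain10|15.lean`, exactly as the rows' own TL theorems; nothing here is a new certificate.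
[cite: Anderson1951, eq. (2)] [cite: KullEtAl2024, §II.B eq. (locTIn), §VI.B]

FILING NOTE (sr-mbsolver-lit-4 g9, 2026-08-22): this module and its sibling `Rows/AndersonDominatedByLTINodes.lean` are
sr-mbsolver-op-07 gen-10's PROVED file `HOME/sr-mbsolver-op-07/lean/AndersonDominatedByLTIProof.lean` (v3, sha256 49ccd6f8a3227803…,
612 lines, 32 theorems + 2 defs, sorry-free; op-07 HOME/INBOX l.4846 / l.4860 / l.4865 'ONE file to land or decline', one-writer rule)
split at its `### The edges into the four chain nodes` heading to respect the gate's 400-line module limit, with the working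
namespace `…CertifiedManyBodySolver.Sketch` renamed `Summit.Ventures.CertifiedManyBodySolver.Rows.AndersonDominatedByLTI`; declarations, statements and
proofs are otherwise VERBATIM except that op-07's two primed weight-sum copies are replaced by the landed Transport lemmas (gate dedup).
`Rows/AndersonDominatedByLTI.lean`: the local `sum_ofLex_eq'`, the cluster placement `boxIdx` / `boxToWindow`, the two LTI identities and the raw
edge `re_firstBond_ge_of_andersonChain`. THIS module: the edges into the four chain node predicates, the half-filled real-`U` forms, the M1
cells and the §6 worked instances on rows #232 / #297 (the two M1-cell re-derivations `m1EnergyLowerRow_of_row232/297_via_lti` are kept as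
`example`s only: their statements equal the landed `Certificates.m1_U8_lower_r232_of` / `_r297_of` — gate dedup).
-/

noncomputable section

open Matrix Complex Finset
open scoped ComplexOrder MatrixOrder BigOperators Matrix.Norms.L2Operator
open Literature.Probability.LatticeModels
open Literature.MathematicalPhysics.QuantumLattice
open Literature.MathematicalPhysics.QuantumLattice.AndersonCluster
open Literature.MathematicalPhysics.QuantumLattice.HubbardWave0
open Literature.MathematicalPhysics.QuantumLattice.ThermodynamicLimit
open Literature.MathematicalPhysics.QuantumLattice.JordanWigner
open Summit.Ventures.CertifiedManyBodySolver.Transport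

namespace Summit.Ventures.CertifiedManyBodySolver.Rows.AndersonDominatedByLTI

/-! ### The edges into the four chain nodes of `Rows/ChainMarginalNodes.lean` -/

/-- **Mean-energy form** (per-spin density `ν` at the site `0`): `q - (U/2)(1 - 2ν) ≤ Re tr(toSpin (Γ(incl) E_Φ) ρ)`.
[cite: Anderson1951, eq. (2)] [cite: KullEtAl2024, §II.B eq. (locTIn)] -/
theorem re_trace_meanEnergy_ge_of_andersonChain (n : ℕ) (U : ℝ) {ℓ : ℕ} (hℓ : ℓ ≤ n + 3) (w v : ℕ → ℝ) (q : ℝ)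
    (hw : ∑ j ∈ Finset.range (ℓ - 1), w j = 1) (hv : ∑ j ∈ Finset.range ℓ, v j = 1)
    (hq : (andersonCluster (halfOpenBox 1 ℓ) 1 U (chainBondWeights w) (chainSiteWeights v) -
      (q : ℂ) • (1 : FermionOp (halfOpenBox 1 ℓ))).PosSemidef)
    {ν : ℝ} {ρ : Op (PolySite (chainWindow (-1) ((n : ℤ) + 1))) 4} (hρ : ρ.PosSemidef) (htr : ρ.trace = 1)
    (hLTI : spinPartialTrace ((PolySite.affEmb 1 (unitVec 0) (chainWindow (-1) (n : ℤ))).trans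
        (PolySite.incl (affShiftSet_chainWindow_subset (-1) (n : ℤ)))) ρ =
      spinPartialTrace (PolySite.incl (chainWindow_mono_right (-1) (by omega : (n : ℤ) ≤ n + 1))) ρ)
    (hdens : ∀ σ : Fin 2,
      ((toSpin (nAt 0 (zero_mem_chainWindow (by omega : (0 : ℤ) ≤ n + 1)) σ) * ρ).trace).re = ν) :
    q - U / 2 * (1 - 2 * ν) ≤
      ((toSpin (fermionEmbed (PolySite.incl (thicken_zero_one_subset_chainWindow (by omega : (1 : ℤ) ≤ n + 1)))
        ((hubbardFermionInteraction 1 1 U).meanEnergyObs 1)) * ρ).trace).re := by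
  have hm : -unitVec 0 ∈ chainWindow (-1) ((n : ℤ) + 1) := (neg_unitVec_mem_chainWindow (by omega : (-1 : ℤ) ≤ n + 1))
  have hz : (0 : Site 1) ∈ chainWindow (-1) ((n : ℤ) + 1) := (zero_mem_chainWindow (by omega : (0 : ℤ) ≤ n + 1))
  have hA := re_firstBond_ge_of_andersonChain n U hℓ w v q hw hv hq hρ htr hLTI hm hz
  have hC := fun σ => trace_nAt_zero_eq_neg_of_lti n hLTI hm hz σ
  rw [trace_meanEnergy_eq_firstBond_of_lti n U hLTI hm hz]
  rw [map_add, Matrix.add_mul, trace_add, Complex.add_re, ← hC 0, ← hC 1, hdens 0, hdens 1] at hA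
  linarith

/-- **EDGE → `LTIChainNode`, half filling, cluster = the whole window (`ℓ = k = n + 3`).** Row dictionary as in
`hubbardChainEnergyDensity_ge_of_andersonChain` (`t = 1`; `w j` = weight of the bond `(j, j+1)`, `v j` = weight of the site `j`,
`q` = the certified floor). [cite: Anderson1951, eq. (2)] [cite: KullEtAl2024, §II.B] -/
theorem ltiChainNode_of_andersonChain (U : ℝ) (n : ℕ) (w v : ℕ → ℝ) (q : ℚ)
    (hw : ∑ j ∈ Finset.range (n + 2), w j = 1) (hv : ∑ j ∈ Finset.range (n + 3), v j = 1)
    (hq : (andersonCluster (halfOpenBox 1 (n + 3)) 1 U (chainBondWeights w) (chainSiteWeights v) -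
      (((q : ℚ) : ℝ) : ℂ) • (1 : FermionOp (halfOpenBox 1 (n + 3)))).PosSemidef) :
    LTIChainNode U n (1 / 2) q := by
  intro ρ hρ htr hLTI _ hdens _ _
  have h := re_trace_meanEnergy_ge_of_andersonChain n U le_rfl w v (q : ℝ)
    (by rw [show n + 3 - 1 = n + 2 by omega]; exact hw) hv hq hρ htr hLTI hdens
  push_cast at h
  linarith

/-- **EDGE → `LTIChainNode`, shorter cluster `ℓ ≤ k` inside the window** (the cluster sits on the window sites
`x_0, …, x_{ℓ-1}`; the unused window sites only enlarge the feasible set). [cite: Anderson1951, eq. (2)] [cite: KullEtAl2024, §II.B] -/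
theorem ltiChainNode_of_andersonChain_le (U : ℝ) (n ℓ : ℕ) (hℓ : ℓ ≤ n + 3) (w v : ℕ → ℝ) (q : ℚ)
    (hw : ∑ j ∈ Finset.range (ℓ - 1), w j = 1) (hv : ∑ j ∈ Finset.range ℓ, v j = 1)
    (hq : (andersonCluster (halfOpenBox 1 ℓ) 1 U (chainBondWeights w) (chainSiteWeights v) -
      (((q : ℚ) : ℝ) : ℂ) • (1 : FermionOp (halfOpenBox 1 ℓ))).PosSemidef) :
    LTIChainNode U n (1 / 2) q := by
  intro ρ hρ htr hLTI _ hdens _ _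
  have h := re_trace_meanEnergy_ge_of_andersonChain n U hℓ w v (q : ℝ) hw hv hq hρ htr hLTI hdens
  push_cast at h
  linarith

/-- **EDGE → `LTIChainNode`, general filling, cluster `ℓ ≤ k`** (`ν` = per-spin density of the node; Anderson's
`(U/2)[n_x ≠ 1]` convention shifts the floor by `(U/2)(1 - 2ν)`, cf. `energyDensity2D_ge_of_andersonRect`).
[cite: Anderson1951, eq. (2)] [cite: KullEtAl2024, §II.B] -/
theorem ltiChainNode_of_andersonChain_doped_le (U : ℚ) (n ℓ : ℕ) (hℓ : ℓ ≤ n + 3) (ν : ℚ) (w v : ℕ → ℝ) (q : ℚ)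
    (hw : ∑ j ∈ Finset.range (ℓ - 1), w j = 1) (hv : ∑ j ∈ Finset.range ℓ, v j = 1)
    (hq : (andersonCluster (halfOpenBox 1 ℓ) 1 (U : ℝ) (chainBondWeights w) (chainSiteWeights v) -
      (((q : ℚ) : ℝ) : ℂ) • (1 : FermionOp (halfOpenBox 1 ℓ))).PosSemidef) :
    LTIChainNode (U : ℝ) n ν (q - U / 2 * (1 - 2 * ν)) := by
  intro ρ hρ htr hLTI _ hdens _ _
  have h := re_trace_meanEnergy_ge_of_andersonChain n (U : ℝ) hℓ w v (q : ℝ) hw hv hq hρ htr hLTI hdens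
  push_cast at h ⊢
  linarith

/-- **EDGE → `LTIChainNode`, general filling, cluster = the whole window** (the signature of the sorry'd sketch
`AndersonDominatedByLTI.lean`). [cite: Anderson1951, eq. (2)] [cite: KullEtAl2024, §II.B] -/
theorem ltiChainNode_of_andersonChain_doped (U : ℚ) (n : ℕ) (ν : ℚ) (w v : ℕ → ℝ) (q : ℚ)
    (hw : ∑ j ∈ Finset.range (n + 2), w j = 1) (hv : ∑ j ∈ Finset.range (n + 3), v j = 1)
    (hq : (andersonCluster (halfOpenBox 1 (n + 3)) 1 (U : ℝ) (chainBondWeights w) (chainSiteWeights v) -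
      (((q : ℚ) : ℝ) : ℂ) • (1 : FermionOp (halfOpenBox 1 (n + 3)))).PosSemidef) :
    LTIChainNode (U : ℝ) n ν (q - U / 2 * (1 - 2 * ν)) :=
  ltiChainNode_of_andersonChain_doped_le U n (n + 3) le_rfl ν w v q (by rw [show n + 3 - 1 = n + 2 by omega]; exact hw) hv hq

/-- **EDGE → `LTIChainKSDNNode` (FORMAT-ltisdp, total density `ν` of the site `-1`, first-bond objective), cluster `ℓ ≤ k`:**
floor `q - (U/2)(1 - ν)`. [cite: Anderson1951, eq. (2)] [cite: KullEtAl2024, §II.B eq. (locTIn), §VI.B] -/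
theorem ltiChainKSDNNode_of_andersonChain_le (U : ℚ) (n ℓ : ℕ) (hℓ : ℓ ≤ n + 3) (ν : ℚ) (w v : ℕ → ℝ) (q : ℚ)
    (hw : ∑ j ∈ Finset.range (ℓ - 1), w j = 1) (hv : ∑ j ∈ Finset.range ℓ, v j = 1)
    (hq : (andersonCluster (halfOpenBox 1 ℓ) 1 (U : ℝ) (chainBondWeights w) (chainSiteWeights v) -
      (((q : ℚ) : ℝ) : ℂ) • (1 : FermionOp (halfOpenBox 1 ℓ))).PosSemidef) :
    LTIChainKSDNNode (U : ℝ) n ν (q - U / 2 * (1 - ν)) := by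
  intro ρ hρ htr hLTI _ hdens _ _
  have hA := re_firstBond_ge_of_andersonChain n (U : ℝ) hℓ w v (q : ℝ) hw hv hq hρ htr hLTI
    (neg_unitVec_mem_chainWindow (by omega : (-1 : ℤ) ≤ n + 1)) (zero_mem_chainWindow (by omega : (0 : ℤ) ≤ n + 1))
  rw [hdens] at hA
  push_cast at hA ⊢
  linarith

/-- **EDGE → `LTIChainKSDNNode` at half filling** (total density `1`): floor `q`. [cite: Anderson1951, eq. (2)] [cite: KullEtAl2024, §VI.B] -/
theorem ltiChainKSDNNode_of_andersonChain (U : ℚ) (n ℓ : ℕ) (hℓ : ℓ ≤ n + 3) (w v : ℕ → ℝ) (q : ℚ)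
    (hw : ∑ j ∈ Finset.range (ℓ - 1), w j = 1) (hv : ∑ j ∈ Finset.range ℓ, v j = 1)
    (hq : (andersonCluster (halfOpenBox 1 ℓ) 1 (U : ℝ) (chainBondWeights w) (chainSiteWeights v) -
      (((q : ℚ) : ℝ) : ℂ) • (1 : FermionOp (halfOpenBox 1 ℓ))).PosSemidef) :
    LTIChainKSDNNode (U : ℝ) n 1 q := by
  have h := ltiChainKSDNNode_of_andersonChain_le U n ℓ hℓ 1 w v q hw hv hq
  norm_num at h
  exact h

/-- **EDGE → `EntChainNode`** (the LTI node's rows plus the entropy row, which is simply not used): via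
`LTIChainNode.entChainNode`. [cite: Anderson1951, eq. (2)] [cite: KullEtAl2024, §II.B] [cite: FawziFawziScalet2024Entropy, Theorem 4.1] -/
theorem entChainNode_of_andersonChain_le (U : ℚ) (n ℓ : ℕ) (hℓ : ℓ ≤ n + 3) (ν : ℚ) (w v : ℕ → ℝ) (q : ℚ)
    (hw : ∑ j ∈ Finset.range (ℓ - 1), w j = 1) (hv : ∑ j ∈ Finset.range ℓ, v j = 1)
    (hq : (andersonCluster (halfOpenBox 1 ℓ) 1 (U : ℝ) (chainBondWeights w) (chainSiteWeights v) -
      (((q : ℚ) : ℝ) : ℂ) • (1 : FermionOp (halfOpenBox 1 ℓ))).PosSemidef) :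
    EntChainNode (U : ℝ) n ν (q - U / 2 * (1 - 2 * ν)) :=
  (ltiChainNode_of_andersonChain_doped_le U n ℓ hℓ ν w v q hw hv hq).entChainNode

/-- **EDGE → `EntTLMChainNode` (op-08's `tl_marginal` form: site-averaged total density `ν` = filling, bond-averaged objective
`h_avg`, entropy row unused), cluster `ℓ ≤ k`:** floor `q - (U/2)(1 - ν)`.
[cite: Anderson1951, eq. (2)] [cite: KullEtAl2024, §II.B eq. (locTIn), §VI.B] [cite: FawziFawziScalet2024Entropy, Theorem 4.1] -/
theorem entTLMChainNode_of_andersonChain_le (U : ℚ) (n ℓ : ℕ) (hℓ : ℓ ≤ n + 3) (ν : ℚ) (w v : ℕ → ℝ) (q : ℚ)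
    (hw : ∑ j ∈ Finset.range (ℓ - 1), w j = 1) (hv : ∑ j ∈ Finset.range ℓ, v j = 1)
    (hq : (andersonCluster (halfOpenBox 1 ℓ) 1 (U : ℝ) (chainBondWeights w) (chainSiteWeights v) -
      (((q : ℚ) : ℝ) : ℂ) • (1 : FermionOp (halfOpenBox 1 ℓ))).PosSemidef) :
    EntTLMChainNode (U : ℝ) n ν (q - U / 2 * (1 - ν)) := by
  intro ρ hρ htr hLTI _ hdens _ _ _
  have hm : -unitVec 0 ∈ chainWindow (-1) ((n : ℤ) + 1) := (neg_unitVec_mem_chainWindow (by omega : (-1 : ℤ) ≤ n + 1))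
  have hz : (0 : Site 1) ∈ chainWindow (-1) ((n : ℤ) + 1) := (zero_mem_chainWindow (by omega : (0 : ℤ) ≤ n + 1))
  have hA := re_firstBond_ge_of_andersonChain n (U : ℝ) hℓ w v (q : ℝ) hw hv hq hρ htr hLTI hm hz
  have hC := fun σ => trace_nAt_zero_eq_neg_of_lti n hLTI hm hz σ
  rw [trace_tlmObjective_eq_of_lti n 1 (U : ℝ) hLTI, trace_meanEnergy_eq_firstBond_of_lti n (U : ℝ) hLTI hm hz]
  rw [trace_tlmDensity_eq_of_lti n hLTI, Fin.sum_univ_two, hC 0, hC 1, ← trace_add, ← Matrix.add_mul, ← map_add] at hdens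
  rw [hdens] at hA
  push_cast at hA ⊢
  linarith

/-- **EDGE → `LTIChainKSDNNode` at half filling, real `U`** (the form instantiated on rows of record, whose `U` is a real
numeral): floor `q`. [cite: Anderson1951, eq. (2)] [cite: KullEtAl2024, §VI.B] -/
theorem ltiChainKSDNNode_halfFilled_of_andersonChain (U : ℝ) (n ℓ : ℕ) (hℓ : ℓ ≤ n + 3) (w v : ℕ → ℝ) (q : ℚ)
    (hw : ∑ j ∈ Finset.range (ℓ - 1), w j = 1) (hv : ∑ j ∈ Finset.range ℓ, v j = 1)
    (hq : (andersonCluster (halfOpenBox 1 ℓ) 1 U (chainBondWeights w) (chainSiteWeights v) -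
      (((q : ℚ) : ℝ) : ℂ) • (1 : FermionOp (halfOpenBox 1 ℓ))).PosSemidef) :
    LTIChainKSDNNode U n 1 q := by
  intro ρ hρ htr hLTI _ hdens _ _
  have hA := re_firstBond_ge_of_andersonChain n U hℓ w v (q : ℝ) hw hv hq hρ htr hLTI
    (neg_unitVec_mem_chainWindow (by omega : (-1 : ℤ) ≤ n + 1)) (zero_mem_chainWindow (by omega : (0 : ℤ) ≤ n + 1))
  rw [hdens] at hA
  push_cast at hA ⊢
  linarith

/-- **EDGE → `EntTLMChainNode` at half filling, real `U`** (op-08's `tl_marginal` form; filling `1`): floor `q`.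
[cite: Anderson1951, eq. (2)] [cite: KullEtAl2024, §VI.B] [cite: FawziFawziScalet2024Entropy, Theorem 4.1] -/
theorem entTLMChainNode_halfFilled_of_andersonChain (U : ℝ) (n ℓ : ℕ) (hℓ : ℓ ≤ n + 3) (w v : ℕ → ℝ) (q : ℚ)
    (hw : ∑ j ∈ Finset.range (ℓ - 1), w j = 1) (hv : ∑ j ∈ Finset.range ℓ, v j = 1)
    (hq : (andersonCluster (halfOpenBox 1 ℓ) 1 U (chainBondWeights w) (chainSiteWeights v) -
      (((q : ℚ) : ℝ) : ℂ) • (1 : FermionOp (halfOpenBox 1 ℓ))).PosSemidef) :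
    EntTLMChainNode U n 1 q := by
  intro ρ hρ htr hLTI _ hdens _ _ _
  have hm : -unitVec 0 ∈ chainWindow (-1) ((n : ℤ) + 1) := (neg_unitVec_mem_chainWindow (by omega : (-1 : ℤ) ≤ n + 1))
  have hz : (0 : Site 1) ∈ chainWindow (-1) ((n : ℤ) + 1) := (zero_mem_chainWindow (by omega : (0 : ℤ) ≤ n + 1))
  have hA := re_firstBond_ge_of_andersonChain n U hℓ w v (q : ℝ) hw hv hq hρ htr hLTI hm hz
  have hC := fun σ => trace_nAt_zero_eq_neg_of_lti n hLTI hm hz σ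
  rw [trace_tlmObjective_eq_of_lti n 1 U hLTI, trace_meanEnergy_eq_firstBond_of_lti n U hLTI hm hz]
  rw [trace_tlmDensity_eq_of_lti n hLTI, Fin.sum_univ_two, hC 0, hC 1, ← trace_add, ← Matrix.add_mul, ← map_add] at hdens
  rw [hdens] at hA
  push_cast at hA ⊢
  linarith

/-! ### The M1 cells by name -/

/-- **COROLLARY BY NAME (the 1-D half of what BET-L2's kill clause asks for):** the LTI node's value dominates every Anderson
row on a cluster that fits in its window; composed with `LTIChainNode.m1EnergyLowerRow` it is the same M1 cell (the signature of the
sorry'd sketch). [cite: Anderson1951, eq. (2)] [cite: KullEtAl2024, §VI.B] -/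
theorem m1EnergyLowerRow_of_andersonChain_via_lti {U : ℝ} (hU : 0 ≤ U) (n : ℕ) (w v : ℕ → ℝ) (q : ℚ)
    (hw : ∑ j ∈ Finset.range (n + 2), w j = 1) (hv : ∑ j ∈ Finset.range (n + 3), v j = 1)
    (hq : (andersonCluster (halfOpenBox 1 (n + 3)) 1 U (chainBondWeights w) (chainSiteWeights v) -
      (((q : ℚ) : ℝ) : ℂ) • (1 : FermionOp (halfOpenBox 1 (n + 3)))).PosSemidef) :
    M1EnergyLowerRow U q :=
  (ltiChainNode_of_andersonChain U n w v q hw hv hq).m1EnergyLowerRow hU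

/-- The same with a shorter cluster `ℓ ≤ n + 3`. [cite: Anderson1951, eq. (2)] [cite: KullEtAl2024, §VI.B] -/
theorem m1EnergyLowerRow_of_andersonChain_via_lti_le {U : ℝ} (hU : 0 ≤ U) (n ℓ : ℕ) (hℓ : ℓ ≤ n + 3) (w v : ℕ → ℝ)
    (q : ℚ) (hw : ∑ j ∈ Finset.range (ℓ - 1), w j = 1) (hv : ∑ j ∈ Finset.range ℓ, v j = 1)
    (hq : (andersonCluster (halfOpenBox 1 ℓ) 1 U (chainBondWeights w) (chainSiteWeights v) -
      (((q : ℚ) : ℝ) : ℂ) • (1 : FermionOp (halfOpenBox 1 ℓ))).PosSemidef) :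
    M1EnergyLowerRow U q :=
  (ltiChainNode_of_andersonChain_le U n ℓ hℓ w v q hw hv hq).m1EnergyLowerRow hU

/-- Doped M1 cell through the LTI node: an Anderson certificate at floor `q` (Anderson convention) on a cluster `ℓ ≤ n + 3`
gives the M1 doped energy LOWER row at filling `p/q'` with the value `q - (U/2)(1 - p/q')` (`ν = p/(2q')` per spin).
[cite: Anderson1951, eq. (2)] [cite: KullEtAl2024, §VI.B] -/
theorem m1DopedEnergyLowerRow_of_andersonChain_via_lti {U : ℚ} (hU : 0 ≤ (U : ℝ)) (n ℓ : ℕ) (hℓ : ℓ ≤ n + 3)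
    {p q' : ℕ} (hq' : 1 ≤ q') (hp : p ≤ 2 * q') (w v : ℕ → ℝ) (q : ℚ)
    (hw : ∑ j ∈ Finset.range (ℓ - 1), w j = 1) (hv : ∑ j ∈ Finset.range ℓ, v j = 1)
    (hq : (andersonCluster (halfOpenBox 1 ℓ) 1 (U : ℝ) (chainBondWeights w) (chainSiteWeights v) -
      (((q : ℚ) : ℝ) : ℂ) • (1 : FermionOp (halfOpenBox 1 ℓ))).PosSemidef) :
    M1DopedEnergyLowerRow (U : ℝ) p q' (q - U / 2 * (1 - 2 * ((p : ℚ) / (2 * q')))) :=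
  (ltiChainNode_of_andersonChain_doped_le U n ℓ hℓ ((p : ℚ) / (2 * q')) w v q hw hv hq).m1DopedEnergyLowerRow hU hq' hp
    (by push_cast; ring)

/-! ## §6 Worked instances on lane-A rows OF RECORD

Nothing here is a new certificate: the hypotheses are the rows' OPEN claim nodes (`@[conjecture] def anderson_psd_…`) of
`Bounds/AndersonRowsChain10.lean` (#232, `ℓ = 10`) and `Bounds/AndersonRowsChain15.lean` (#297, `ℓ = 15`), exactly as in the rows' own
TL theorems `anderson_lower_TL_…`; the conclusions say that the row's floor is a feasible slot of every chain window node with at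
least `ℓ` sites (`n + 3 ≥ ℓ`), in each of the node formats, and re-derive the row's M1 cell through the window node. -/

section Instances

open Summit.HubbardSuperconductivity.ManyBodyBootstrap.Bounds

/-- Row #232 (`pub-mbboot-sdp1:anderson_chain_l10_opt_U8`, `ℓ = 10`, `U = 8`): its claim node is the slot `-3318681/10000000`
of the LTI window node on every window with `≥ 10` sites. [cite: Anderson1951, eq. (2)] [cite: KullEtAl2024, §VI.B] -/
theorem ltiChainNode_of_row232 (h : anderson_psd_chain_l10_opt_U8) (n : ℕ) (hn : 7 ≤ n) :
    LTIChainNode 8 n (1 / 2) (-3318681/10000000) :=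
  ltiChainNode_of_andersonChain_le 8 n 10 (by omega) w_chain_l10_opt_U8 v_chain_l10_opt_U8 _
    (by norm_num [Finset.sum_range_succ, w_chain_l10_opt_U8]) (by norm_num [Finset.sum_range_succ, v_chain_l10_opt_U8]) h

/-- Row #232 in FORMAT-ltisdp (`LTIChainKSDNNode`, total density `1`). [cite: Anderson1951, eq. (2)] [cite: KullEtAl2024, §VI.B] -/
theorem ltiChainKSDNNode_of_row232 (h : anderson_psd_chain_l10_opt_U8) (n : ℕ) (hn : 7 ≤ n) :
    LTIChainKSDNNode 8 n 1 (-3318681/10000000) :=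
  ltiChainKSDNNode_halfFilled_of_andersonChain 8 n 10 (by omega) w_chain_l10_opt_U8 v_chain_l10_opt_U8 _
    (by norm_num [Finset.sum_range_succ, w_chain_l10_opt_U8]) (by norm_num [Finset.sum_range_succ, v_chain_l10_opt_U8]) h

/-- Row #232 in op-08's `tl_marginal` form (`EntTLMChainNode`, filling `1`). [cite: Anderson1951, eq. (2)] [cite: KullEtAl2024, §VI.B] -/
theorem entTLMChainNode_of_row232 (h : anderson_psd_chain_l10_opt_U8) (n : ℕ) (hn : 7 ≤ n) :
    EntTLMChainNode 8 n 1 (-3318681/10000000) :=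
  entTLMChainNode_halfFilled_of_andersonChain 8 n 10 (by omega) w_chain_l10_opt_U8 v_chain_l10_opt_U8 _
    (by norm_num [Finset.sum_range_succ, w_chain_l10_opt_U8]) (by norm_num [Finset.sum_range_succ, v_chain_l10_opt_U8]) h

/- Row #232's M1 cell re-derived THROUGH the 10-site LTI window node is the term
`(ltiChainNode_of_row232 h 7 le_rfl).m1EnergyLowerRow (by norm_num) : M1EnergyLowerRow 8 (-3318681/10000000)` — the SAME statement as the
landed `Certificates.m1_U8_lower_r232_of` (`Certificates/HubbardChain_n1_lanea_l10.lean`), hence not re-declared here (gate dedup; op-07's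
`m1EnergyLowerRow_of_row232_via_lti` is that term). -/
example (h : anderson_psd_chain_l10_opt_U8) : M1EnergyLowerRow 8 (-3318681/10000000) :=
  (ltiChainNode_of_row232 h 7 le_rfl).m1EnergyLowerRow (by norm_num)

/-- Row #297 (`pub-mbboot-sdp1:anderson_cw_chain_l15_U8_v040`, `ℓ = 15`, `U = 8`, the best half-filled `U = 8` Anderson row of
record): its claim node is the slot `-3292151/10000000` of the LTI window node on every window with `≥ 15` sites.
[cite: Anderson1951, eq. (2)] [cite: KullEtAl2024, §VI.B] -/
theorem ltiChainNode_of_row297 (h : anderson_psd_cw_chain_l15_U8_v040) (n : ℕ) (hn : 12 ≤ n) :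
    LTIChainNode 8 n (1 / 2) (-3292151/10000000) :=
  ltiChainNode_of_andersonChain_le 8 n 15 (by omega) w_cw_chain_l15_U8_v040 v_cw_chain_l15_U8_v040 _
    (by norm_num [Finset.sum_range_succ, w_cw_chain_l15_U8_v040]) (by norm_num [Finset.sum_range_succ, v_cw_chain_l15_U8_v040]) h

/-- Row #297 in FORMAT-ltisdp (`LTIChainKSDNNode`, total density `1`). [cite: Anderson1951, eq. (2)] [cite: KullEtAl2024, §VI.B] -/
theorem ltiChainKSDNNode_of_row297 (h : anderson_psd_cw_chain_l15_U8_v040) (n : ℕ) (hn : 12 ≤ n) :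
    LTIChainKSDNNode 8 n 1 (-3292151/10000000) :=
  ltiChainKSDNNode_halfFilled_of_andersonChain 8 n 15 (by omega) w_cw_chain_l15_U8_v040 v_cw_chain_l15_U8_v040 _
    (by norm_num [Finset.sum_range_succ, w_cw_chain_l15_U8_v040]) (by norm_num [Finset.sum_range_succ, v_cw_chain_l15_U8_v040]) h

/-- Row #297 in op-08's `tl_marginal` form (`EntTLMChainNode`, filling `1`). [cite: Anderson1951, eq. (2)] [cite: KullEtAl2024, §VI.B] -/
theorem entTLMChainNode_of_row297 (h : anderson_psd_cw_chain_l15_U8_v040) (n : ℕ) (hn : 12 ≤ n) :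
    EntTLMChainNode 8 n 1 (-3292151/10000000) :=
  entTLMChainNode_halfFilled_of_andersonChain 8 n 15 (by omega) w_cw_chain_l15_U8_v040 v_cw_chain_l15_U8_v040 _
    (by norm_num [Finset.sum_range_succ, w_cw_chain_l15_U8_v040]) (by norm_num [Finset.sum_range_succ, v_cw_chain_l15_U8_v040]) h

/- Row #297's M1 cell through the 15-site LTI window node: the term below has the SAME statement as the landed
`Certificates.m1_U8_lower_r297_of` (`Certificates/HubbardChain_n1_lanea_l15.lean`) — checked as an `example`, not re-declared (gate dedup;
op-07's `m1EnergyLowerRow_of_row297_via_lti`). -/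
example (h : anderson_psd_cw_chain_l15_U8_v040) : M1EnergyLowerRow 8 (-3292151/10000000) :=
  (ltiChainNode_of_row297 h 12 le_rfl).m1EnergyLowerRow (by norm_num)

end Instances

end Summit.Ventures.CertifiedManyBodySolver.Rows.AndersonDominatedByLTI

end
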